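import Summits.ABC.StewartYu.RecordExitCCappedKeys
import HarnessLib

/-!
# Exit C of the Gen-3 record on the CAPPED letters, II: the COVOLUME clause (C) of `RecordArchW` (archimedean one-stage
# record `ArchG3Rec`, plan R41 / p1 memo `ArchG3Rec-END-capped` §(C); seat p4 g10, r2 line `arch-g3-frame`)

`Summits/ABC/StewartYu/RecordExitCCapped.lean` — cell `abc-stewartyu`, route `YuMatveevShapeRat`, crux r2 `ArchCoreRat`
(stmt-ABC-20502). Theorems only; no named facts.  Prequel: `RecordExitCCappedKeys.lean` (slack function `Yslack`, the four
scalar comparisons).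

Clause (C) of `GenThreeFrameSpecArchW.RecordArchW C Y n A D₀ S₀ X D` asks, for `0 < r < n`, `d₀ ≤ 1`, every `r × n`
integer matrix `M` satisfying the exit-C inequality of the zero estimate and every injective non-singular column selection
`κ`, the covolume clause `(r!)²·nʳ·|det M_κ|·∏ᵢ A(κ i)·Y r ≤ Ω` (`Ω = ∏ⱼ Aⱼ`).  The matrix is removed by
`RecordExits.exitC_det_le` (one term of the minors sum; `exitC_det_prodDV_le`) and the product `∏ᵢ D(κ i)·A(κ i)` is
bounded by a HEAVY/LIGHT split INSIDE `κ`: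

* `prod_DV_le_of_heavy` — if some `A(κ i₀) > ρ` then `D(κ i₀) = 1` and `∏ᵢ D(κ i)A(κ i) ≤ (2ρ)^{r−1}·Ω`;
* `prod_DV_le_of_light` — if every `A(κ i) ≤ ρ` then `∏ᵢ D(κ i)A(κ i) ≤ (2ρ)ʳ`;

so that `Ω` cancels (heavy) or absorbs exactly one box scale `L` (light: through the END floor `3(n+1)L ≤ 2c_K·X·Ω` when
`d₀ = 1`, through `D₀ ≤ 8X·c_K·Ω` when `d₀ = 0`).  `exitC_capped` is clause (C) verbatim at `Y = Yslack c_K n` on the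
capped letters.  NO logarithmic (5.22) line, no `hcorner`.

WHAT THIS IS NOT: no choice of the record's letters (p1's `ArchG3Rec`), no clause (N) numerics; no crux moves.

## References
* [Nesterenko2003] Yu. V. Nesterenko, LNM 1819 (2003) — §5.2 (5.13), (5.19)–(5.22), Lemmas 5.3–5.4 (pp. 99–106).
* [Matveev2000] E. M. Matveev, Izv. Math. 64 (2000) — (1.3) (the pivot-weighted covolume currency).
-/

noncomputable section

open Finset Real Nat
open Literature.NumberTheory.Transcendental
open Literature.NumberTheory.Transcendental.GaGm

namespace Summit.ABC.StewartYu.RecordExits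

variable {n r : ℕ}

/-! ### The heavy/light split inside a column selection -/

/-- One factor: `Dⱼ·Vⱼ ≤ 2ρ·Vⱼ` (from `Dⱼ ≤ ρ/Vⱼ + 1`, `ρ, Vⱼ ≥ 1`). [folklore] -/
theorem DV_le_two_rho_mul {V : Fin n → ℝ} (hV1 : ∀ j, 1 ≤ V j) {D : Fin n → ℕ} {ρ : ℝ}
    (hDρ : ∀ j, (D j : ℝ) ≤ ρ / V j + 1) (hρ1 : 1 ≤ ρ) (j : Fin n) :
    (D j : ℝ) * V j ≤ 2 * ρ * V j := by
  have hV : 0 < V j := by linarith [hV1 j]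
  have h1 : (D j : ℝ) * V j ≤ ρ + V j := by
    calc (D j : ℝ) * V j ≤ (ρ / V j + 1) * V j := mul_le_mul_of_nonneg_right (hDρ j) hV.le
      _ = ρ + V j := by field_simp
  nlinarith [hV1 j]

/-- One LIGHT factor: `Dⱼ·Vⱼ ≤ 2ρ` when `Vⱼ ≤ ρ`. [folklore] -/
theorem DV_le_two_rho {V : Fin n → ℝ} (hV1 : ∀ j, 1 ≤ V j) {D : Fin n → ℕ} {ρ : ℝ}
    (hDρ : ∀ j, (D j : ℝ) ≤ ρ / V j + 1) {j : Fin n} (h : V j ≤ ρ) :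
    (D j : ℝ) * V j ≤ 2 * ρ := by
  have hV : 0 < V j := by linarith [hV1 j]
  have h1 : (D j : ℝ) * V j ≤ ρ + V j := by
    calc (D j : ℝ) * V j ≤ (ρ / V j + 1) * V j := mul_le_mul_of_nonneg_right (hDρ j) hV.le
      _ = ρ + V j := by field_simp
  linarith

/-- One HEAVY factor: `Dⱼ·Vⱼ ≤ Vⱼ` when `ρ < Vⱼ` (then `Dⱼ ≤ 1`). [folklore] -/
theorem DV_le_self_of_heavy {V : Fin n → ℝ} (hV1 : ∀ j, 1 ≤ V j) {D : Fin n → ℕ} {ρ : ℝ}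
    (hDρ : ∀ j, (D j : ℝ) ≤ ρ / V j + 1) {j : Fin n} (h : ρ < V j) :
    (D j : ℝ) * V j ≤ V j := by
  have hV : 0 < V j := by linarith [hV1 j]
  have h2 : ρ / V j < 1 := (div_lt_one hV).mpr h
  have h3 : (D j : ℝ) < 2 := by linarith [hDρ j]
  have h4 : D j < 2 := by exact_mod_cast h3
  have h5 : (D j : ℝ) ≤ 1 := by exact_mod_cast Nat.lt_succ_iff.mp h4
  nlinarith

/-- A selection of the weights has product at most `Ω` (injective `κ`, all weights `≥ 1`). [folklore] -/
theorem prod_comp_le_prod (κ : Fin r → Fin n) (hκ : Function.Injective κ) {V : Fin n → ℝ}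
    (hV1 : ∀ j, 1 ≤ V j) : ∏ i, V (κ i) ≤ ∏ j, V j := by
  classical
  rw [← Finset.prod_image (s := univ) (f := V) (g := κ) fun x _ y _ hxy => hκ hxy]
  rw [← Finset.prod_sdiff (subset_univ (univ.image κ))]
  have h1 : 1 ≤ ∏ j ∈ univ \ univ.image κ, V j := Finset.one_le_prod fun j _ => hV1 j
  have h0 : 0 ≤ ∏ j ∈ univ.image κ, V j := prod_nonneg fun j _ => by linarith [hV1 j]
  exact le_mul_of_one_le_left h0 h1

/-- **HEAVY selection**: if some `A(κ i₀) > ρ` then `∏ᵢ D(κ i)·A(κ i) ≤ (2ρ)^{r−1}·∏ⱼ Aⱼ`.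
[cite: Nesterenko2003, §5.2 (5.18); shape only] -/
theorem prod_DV_le_of_heavy (κ : Fin r → Fin n) (hκ : Function.Injective κ) {V : Fin n → ℝ}
    (hV1 : ∀ j, 1 ≤ V j) {D : Fin n → ℕ} {ρ : ℝ} (hDρ : ∀ j, (D j : ℝ) ≤ ρ / V j + 1) (hρ1 : 1 ≤ ρ)
    {i₀ : Fin r} (h : ρ < V (κ i₀)) :
    ∏ i, ((D (κ i) : ℝ) * V (κ i)) ≤ (2 * ρ) ^ (r - 1) * ∏ j, V j := by
  classical
  have hVpos : ∀ j, 0 < V j := fun j => by linarith [hV1 j]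
  have hρ0 : 0 ≤ ρ := by linarith
  rw [← Finset.mul_prod_erase univ (fun i => (D (κ i) : ℝ) * V (κ i)) (mem_univ i₀)]
  have hcard : (univ.erase i₀).card = r - 1 := by
    rw [card_erase_of_mem (mem_univ _), Finset.card_univ, Fintype.card_fin]
  have hrest : ∏ i ∈ univ.erase i₀, ((D (κ i) : ℝ) * V (κ i)) ≤ ∏ i ∈ univ.erase i₀, (2 * ρ * V (κ i)) :=
    prod_le_prod (fun i _ => mul_nonneg (Nat.cast_nonneg _) (hVpos _).le) fun i _ => DV_le_two_rho_mul hV1 hDρ hρ1 _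
  have e : ∏ i ∈ univ.erase i₀, (2 * ρ * V (κ i)) = (2 * ρ) ^ (r - 1) * ∏ i ∈ univ.erase i₀, V (κ i) := by
    rw [prod_mul_distrib, prod_const, hcard]
  have hsub : V (κ i₀) * ∏ i ∈ univ.erase i₀, V (κ i) = ∏ i, V (κ i) :=
    Finset.mul_prod_erase univ (fun i => V (κ i)) (mem_univ i₀)
  have hle := prod_comp_le_prod κ hκ hV1
  calc (D (κ i₀) : ℝ) * V (κ i₀) * ∏ i ∈ univ.erase i₀, ((D (κ i) : ℝ) * V (κ i))
      ≤ V (κ i₀) * ((2 * ρ) ^ (r - 1) * ∏ i ∈ univ.erase i₀, V (κ i)) := by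
        rw [← e]
        exact mul_le_mul (DV_le_self_of_heavy hV1 hDρ h) hrest
          (prod_nonneg fun i _ => mul_nonneg (Nat.cast_nonneg _) (hVpos _).le) (hVpos _).le
    _ = (2 * ρ) ^ (r - 1) * ∏ i, V (κ i) := by rw [← hsub]; ring
    _ ≤ (2 * ρ) ^ (r - 1) * ∏ j, V j := mul_le_mul_of_nonneg_left hle (by positivity)

/-- **LIGHT selection**: if every `A(κ i) ≤ ρ` then `∏ᵢ D(κ i)·A(κ i) ≤ (2ρ)ʳ`.
[cite: Nesterenko2003, §5.2 (5.18); shape only] -/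
theorem prod_DV_le_of_light (κ : Fin r → Fin n) {V : Fin n → ℝ} (hV1 : ∀ j, 1 ≤ V j) {D : Fin n → ℕ}
    {ρ : ℝ} (hDρ : ∀ j, (D j : ℝ) ≤ ρ / V j + 1) (h : ∀ i, V (κ i) ≤ ρ) :
    ∏ i, ((D (κ i) : ℝ) * V (κ i)) ≤ (2 * ρ) ^ r := by
  have hVpos : ∀ j, 0 < V j := fun j => by linarith [hV1 j]
  calc ∏ i, ((D (κ i) : ℝ) * V (κ i)) ≤ ∏ _i : Fin r, (2 * ρ) :=
        prod_le_prod (fun i _ => by have := hVpos (κ i); positivity) fun i _ => DV_le_two_rho hV1 hDρ (h i)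
    _ = (2 * ρ) ^ r := by rw [prod_const, Finset.card_univ, Fintype.card_fin]

/-! ### The exit inequality against the weighted product of the selection -/

/-- **Exit C against the weighted product of the selection**: for every injective `κ`,
`c₀·(|det M_κ|·∏ᵢ V(κ i)) ≤ (n+1)!·2ⁿ·D₀·∏ᵢ D(κ i)·V(κ i)` with
`c₀ = choose(S₀+ℓ,ℓ)·(2X+1)·(d₀+n−r)!·2^{n−r}·D₀^{d₀}` (from `exitC_det_le`). [cite: Nesterenko2003, §5.2 (5.13), (5.21)] -/
theorem exitC_det_prodDV_le (M : Matrix (Fin r) (Fin n) ℤ) {D : Fin n → ℕ} (hD1 : ∀ j, 1 ≤ D j)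
    {V : Fin n → ℝ} (hV0 : ∀ j, 0 ≤ V j) {d₀ D₀ S₀ X ℓ : ℕ}
    (h : Nat.choose (S₀ + ℓ) ℓ * (2 * X + 1) * nesterenkoH n r d₀ M D₀ D ≤
      (n + 1).factorial * 2 ^ n * D₀ * ∏ j, D j)
    (κ : Fin r → Fin n) (hκ : Function.Injective κ) :
    ((Nat.choose (S₀ + ℓ) ℓ * (2 * X + 1) * ((d₀ + (n - r)).factorial * 2 ^ (n - r) * D₀ ^ d₀) : ℕ) : ℝ) *
        (|(Matrix.of fun i j => (M j (κ i) : ℝ)).det| * ∏ i, V (κ i)) ≤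
      (((n + 1).factorial * 2 ^ n * D₀ : ℕ) : ℝ) * ∏ i, ((D (κ i) : ℝ) * V (κ i)) := by
  have hN := exitC_det_le M hD1 h κ hκ
  set c : ℝ := ((Nat.choose (S₀ + ℓ) ℓ * (2 * X + 1) *
      ((d₀ + (n - r)).factorial * 2 ^ (n - r) * D₀ ^ d₀) : ℕ) : ℝ) with hc
  set B : ℝ := (((n + 1).factorial * 2 ^ n * D₀ : ℕ) : ℝ) with hB
  have hR : c * (((Matrix.of fun i j => M j (κ i)).det).natAbs : ℝ) ≤ B * ∏ i, (D (κ i) : ℝ) := by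
    have := (Nat.cast_le (α := ℝ)).mpr hN
    rw [hc, hB]
    push_cast at this ⊢
    linarith
  have hprodV : 0 ≤ ∏ i, V (κ i) := Finset.prod_nonneg fun i _ => hV0 _
  rw [abs_det_cols_cast]
  calc c * ((((Matrix.of fun i j => M j (κ i)).det).natAbs : ℝ) * ∏ i, V (κ i))
      = (c * (((Matrix.of fun i j => M j (κ i)).det).natAbs : ℝ)) * ∏ i, V (κ i) := by ring
    _ ≤ (B * ∏ i, (D (κ i) : ℝ)) * ∏ i, V (κ i) := mul_le_mul_of_nonneg_right hR hprodV
    _ = B * ∏ i, ((D (κ i) : ℝ) * V (κ i)) := by rw [mul_assoc, ← Finset.prod_mul_distrib]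



/-! ### Clause (C) on the capped letters -/

/-- **CLAUSE (C) OF `RecordArchW` ON THE CAPPED LETTERS** at the slack function `Y = Yslack c_K n`: for `0 < r < n`,
`d₀ ≤ 1`, every `r × n` integer matrix satisfying the exit-C inequality and every injective column selection `κ`,
`(r!)²·nʳ·(|det M_κ|·∏ᵢ A(κ i))·Y r ≤ Ω`.  Hypotheses: the letters of an archimedean capped record
(`Dⱼ ≤ ρ/Aⱼ + 1`, `1 ≤ ρ`, `2ρ ≤ L/2^{n+22}`, `64(n+1) ≤ X`, `1 ≤ D₀ ≤ XL/2`, `D₀ ≤ 8X·c_K·Ω`,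
`16(n+1)L ≤ (S₀+1)(n+2)⁴`, `2^{n+23}X ≤ 2X_f+1`, `3(n+1)L ≤ 2c_K·X·Ω`, `2^{n+18} ≤ c_K`).
[cite: Nesterenko2003, §5.2 (5.13), (5.19)–(5.22)] -/
theorem exitC_capped {V : Fin n → ℝ} (hV1 : ∀ j, 1 ≤ V j) {D : Fin n → ℕ} (hD1 : ∀ j, 1 ≤ D j)
    {ρ L X cK : ℝ} {S₀ Xf D₀ : ℕ}
    (hDρ : ∀ j, (D j : ℝ) ≤ ρ / V j + 1) (hρ1 : 1 ≤ ρ) (hρ : 2 * ρ ≤ L / 2 ^ (n + 22))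
    (hX : 64 * ((n : ℝ) + 1) ≤ X) (hD₀1 : 1 ≤ D₀) (hD₀half : (D₀ : ℝ) ≤ X * L / 2)
    (hD₀Ω : (D₀ : ℝ) ≤ 8 * X * cK * ∏ j, V j)
    (hs : (16 : ℝ) * ((n : ℝ) + 1) * L ≤ ((S₀ : ℝ) + 1) * ((n : ℝ) + 2) ^ 4)
    (hxf : (2 : ℝ) ^ (n + 23) * X ≤ 2 * (Xf : ℝ) + 1)
    (hLX : 3 * ((n : ℝ) + 1) * L ≤ 2 * cK * X * ∏ j, V j) (hcK : (2 : ℝ) ^ (n + 18) ≤ cK) :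
    ∀ (r d₀ : ℕ) (M : Matrix (Fin r) (Fin n) ℤ), 0 < r → r < n → d₀ ≤ 1 →
      LinearIndependent ℤ (fun i => M i) →
      Nat.choose (S₀ + (r - d₀)) (r - d₀) * (2 * Xf + 1) * nesterenkoH n r d₀ M D₀ D ≤
          (n + 1).factorial * 2 ^ n * D₀ * ∏ j, D j →
      ∀ κ : Fin r → Fin n, Function.Injective κ →
        (Matrix.of fun i j => (M j (κ i) : ℝ)).det ≠ 0 →
        ((r.factorial : ℝ)) ^ 2 * (n : ℝ) ^ r *
            (|(Matrix.of fun i j => (M j (κ i) : ℝ)).det| * ∏ i, V (κ i)) * Yslack cK n r ≤ ∏ j, V j := by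
  intro r d₀ M hr0 hrn hd₀ _hM h κ hκ _hdet
  obtain ⟨s, rfl⟩ : ∃ s, r = s + 1 := ⟨r - 1, by omega⟩
  obtain ⟨t, rfl⟩ : ∃ t, n = s + 2 + t := ⟨n - s - 2, by omega⟩
  -- positivity of the letters
  have hV0 : ∀ j, 0 ≤ V j := fun j => by linarith [hV1 j]
  have hΩ : 0 < ∏ j, V j := prod_pos fun j _ => by linarith [hV1 j]
  have hcK0 : 0 < cK := lt_of_lt_of_le (by positivity) hcK
  have hX0 : 0 ≤ X := le_trans (by positivity) hX
  have hρ0 : 0 ≤ ρ := by linarith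
  -- the box scale `u = L/2^{n+22}`
  set u : ℝ := L / 2 ^ (s + 2 + t + 22) with hu
  have hL : L = 2 ^ (s + 2 + t + 22) * u := by rw [hu]; field_simp
  have hn : ((s + 2 + t : ℕ) : ℝ) = (s : ℝ) + 2 + t := by push_cast; ring
  rw [hn] at hX hs hLX
  rw [hL] at hs hLX hD₀half
  -- the exit inequality against the weighted product of the selection
  have hc := exitC_det_prodDV_le M hD1 hV0 h κ hκ
  have hc0pos := RecordExitsNumeric.den_pos_of (n := s + 2 + t) (S₀ := S₀) (Xf := Xf) hD₀1 (s + 1) d₀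
  set c₀ : ℝ := ((Nat.choose (S₀ + (s + 1 - d₀)) (s + 1 - d₀) * (2 * Xf + 1) *
      ((d₀ + (s + 2 + t - (s + 1)))! * 2 ^ (s + 2 + t - (s + 1)) * D₀ ^ d₀) : ℕ) : ℝ) with hc0def
  set P₀ : ℝ := |(Matrix.of fun i j => (M j (κ i) : ℝ)).det| * ∏ i, V (κ i) with hP0def
  set PK : ℝ := ∏ i, ((D (κ i) : ℝ) * V (κ i)) with hPKdef
  have hB : ((((s + 2 + t + 1)! * 2 ^ (s + 2 + t) * D₀ : ℕ)) : ℝ) =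
      (((s + 2 + t + 1)! : ℕ) : ℝ) * 2 ^ (s + 2 + t) * (D₀ : ℝ) := by push_cast; ring
  rw [hB] at hc
  have hY0 : 0 ≤ Yslack cK (s + 2 + t) (s + 1) := (Yslack_pos hcK0 (by omega) _).le
  have hF0 : (0 : ℝ) ≤ (((s + 1)! : ℕ) : ℝ) ^ 2 * ((s + 2 + t : ℕ) : ℝ) ^ (s + 1) := by positivity
  -- reduction to the scalar comparison `(r!)²nʳ·Y·B·PK ≤ c₀·Ω`
  suffices key : (((s + 1)! : ℕ) : ℝ) ^ 2 * ((s : ℝ) + 2 + t) ^ (s + 1) * Yslack cK (s + 2 + t) (s + 1) *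
      ((((s + 2 + t + 1)! : ℕ) : ℝ) * 2 ^ (s + 2 + t) * (D₀ : ℝ)) * PK ≤ c₀ * ∏ j, V j by
    rw [hn]
    refine le_of_mul_le_mul_right ?_ hc0pos
    calc (((s + 1)! : ℕ) : ℝ) ^ 2 * ((s : ℝ) + 2 + t) ^ (s + 1) * P₀ * Yslack cK (s + 2 + t) (s + 1) * c₀
        = (((s + 1)! : ℕ) : ℝ) ^ 2 * ((s : ℝ) + 2 + t) ^ (s + 1) * Yslack cK (s + 2 + t) (s + 1) * (c₀ * P₀) := by
          ring
      _ ≤ (((s + 1)! : ℕ) : ℝ) ^ 2 * ((s : ℝ) + 2 + t) ^ (s + 1) * Yslack cK (s + 2 + t) (s + 1) *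
            (((((s + 2 + t + 1)! : ℕ) : ℝ) * 2 ^ (s + 2 + t) * (D₀ : ℝ)) * PK) :=
          mul_le_mul_of_nonneg_left hc (by positivity)
      _ = (((s + 1)! : ℕ) : ℝ) ^ 2 * ((s : ℝ) + 2 + t) ^ (s + 1) * Yslack cK (s + 2 + t) (s + 1) *
            ((((s + 2 + t + 1)! : ℕ) : ℝ) * 2 ^ (s + 2 + t) * (D₀ : ℝ)) * PK := by ring
      _ ≤ c₀ * ∏ j, V j := key
      _ = (∏ j, V j) * c₀ := mul_comm _ _
  -- the `Y`-side is nonnegative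
  have hT0 : 0 ≤ (((s + 1)! : ℕ) : ℝ) ^ 2 * ((s : ℝ) + 2 + t) ^ (s + 1) * Yslack cK (s + 2 + t) (s + 1) *
      ((((s + 2 + t + 1)! : ℕ) : ℝ) * 2 ^ (s + 2 + t) * (D₀ : ℝ)) := by positivity
  have e3 : s + 2 + t - (s + 1) = t + 1 := by omega
  -- normal forms of `c₀` for `d₀ = 0` and `d₀ = 1`
  interval_cases d₀
  · -- `d₀ = 0`
    have hc0 : c₀ = ((Nat.choose (S₀ + (s + 1)) (s + 1) : ℕ) : ℝ) * (2 * (Xf : ℝ) + 1) *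
        ((((t + 1)! : ℕ) : ℝ) * 2 ^ (t + 1)) := by
      rw [hc0def, e3]; push_cast; ring
    rw [hc0]
    by_cases hheavy : ∃ i, ρ < V (κ i)
    · obtain ⟨i₀, hi₀⟩ := hheavy
      have hPK : PK ≤ (2 * ρ) ^ s * ∏ j, V j := by
        simpa using prod_DV_le_of_heavy κ hκ hV1 hDρ hρ1 hi₀
      have hk := keyH0 s t (S₀ := S₀) (Xf := Xf) (D₀ := D₀) hcK hρ0 hρ hX0 hD₀half hs hxf
      calc _ ≤ (((s + 1)! : ℕ) : ℝ) ^ 2 * ((s : ℝ) + 2 + t) ^ (s + 1) * Yslack cK (s + 2 + t) (s + 1) *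
            ((((s + 2 + t + 1)! : ℕ) : ℝ) * 2 ^ (s + 2 + t) * (D₀ : ℝ)) * ((2 * ρ) ^ s * ∏ j, V j) :=
            mul_le_mul_of_nonneg_left hPK hT0
        _ = (((s + 1)! : ℕ) : ℝ) ^ 2 * ((s : ℝ) + 2 + t) ^ (s + 1) * Yslack cK (s + 2 + t) (s + 1) *
            ((((s + 2 + t + 1)! : ℕ) : ℝ) * 2 ^ (s + 2 + t) * (D₀ : ℝ)) * (2 * ρ) ^ s * ∏ j, V j := by ring
        _ ≤ _ := mul_le_mul_of_nonneg_right hk hΩ.le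
    · push Not at hheavy
      have hPK : PK ≤ (2 * ρ) ^ (s + 1) := prod_DV_le_of_light κ hV1 hDρ hheavy
      have hk := keyL0 s t (S₀ := S₀) (Xf := Xf) (D₀ := D₀) hcK0 hρ0 hρ hX0 hΩ.le hD₀Ω hs hxf
      calc _ ≤ (((s + 1)! : ℕ) : ℝ) ^ 2 * ((s : ℝ) + 2 + t) ^ (s + 1) * Yslack cK (s + 2 + t) (s + 1) *
            ((((s + 2 + t + 1)! : ℕ) : ℝ) * 2 ^ (s + 2 + t) * (D₀ : ℝ)) * (2 * ρ) ^ (s + 1) :=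
            mul_le_mul_of_nonneg_left hPK hT0
        _ ≤ _ := hk
  · -- `d₀ = 1`
    have hc0 : c₀ = ((Nat.choose (S₀ + s) s : ℕ) : ℝ) * (2 * (Xf : ℝ) + 1) *
        ((((t + 2)! : ℕ) : ℝ) * 2 ^ (t + 1) * (D₀ : ℝ)) := by
      rw [hc0def, e3, show 1 + (t + 1) = t + 2 by ring, Nat.add_sub_cancel]; push_cast; ring
    rw [hc0]
    by_cases hheavy : ∃ i, ρ < V (κ i)
    · obtain ⟨i₀, hi₀⟩ := hheavy
      have hPK : PK ≤ (2 * ρ) ^ s * ∏ j, V j := by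
        simpa using prod_DV_le_of_heavy κ hκ hV1 hDρ hρ1 hi₀
      have hk := keyH1 s t (S₀ := S₀) (Xf := Xf) (D₀ := D₀) hcK hρ0 hρ hX hs hxf
      calc _ ≤ (((s + 1)! : ℕ) : ℝ) ^ 2 * ((s : ℝ) + 2 + t) ^ (s + 1) * Yslack cK (s + 2 + t) (s + 1) *
            ((((s + 2 + t + 1)! : ℕ) : ℝ) * 2 ^ (s + 2 + t) * (D₀ : ℝ)) * ((2 * ρ) ^ s * ∏ j, V j) :=
            mul_le_mul_of_nonneg_left hPK hT0
        _ = (((s + 1)! : ℕ) : ℝ) ^ 2 * ((s : ℝ) + 2 + t) ^ (s + 1) * Yslack cK (s + 2 + t) (s + 1) *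
            ((((s + 2 + t + 1)! : ℕ) : ℝ) * 2 ^ (s + 2 + t) * (D₀ : ℝ)) * (2 * ρ) ^ s * ∏ j, V j := by ring
        _ ≤ _ := mul_le_mul_of_nonneg_right hk hΩ.le
    · push Not at hheavy
      have hPK : PK ≤ (2 * ρ) ^ (s + 1) := prod_DV_le_of_light κ hV1 hDρ hheavy
      have hk := keyL1 s t (S₀ := S₀) (Xf := Xf) (D₀ := D₀) hcK0 hρ0 hρ hΩ.le hLX hs hxf
      calc _ ≤ (((s + 1)! : ℕ) : ℝ) ^ 2 * ((s : ℝ) + 2 + t) ^ (s + 1) * Yslack cK (s + 2 + t) (s + 1) *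
            ((((s + 2 + t + 1)! : ℕ) : ℝ) * 2 ^ (s + 2 + t) * (D₀ : ℝ)) * (2 * ρ) ^ (s + 1) :=
            mul_le_mul_of_nonneg_left hPK hT0
        _ ≤ _ := hk

end Summit.ABC.StewartYu.RecordExits

end
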